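import Literature.Computability.Complexity.Transducers
import Literature.Computability.Complexity.TM2Iterate
import Literature.Computability.Complexity.UnaryArithMachines
import Literature.Computability.Complexity.ReductionsProofs
import Literature.Computability.Complexity.StringCopy
import Literature.Computability.Complexity.TimeBoundsComplProofs
import HarnessLib

/-!
# The witness-length test `|y| ≤ p(|x|)` on `⟨x, y⟩` is polynomial time (trunk CplxCore)

The certificate calculus of `NP = ∃·P` bounds witnesses by `|y| ≤ p(|x|)` (Arora–Barak 2009,
Def. 2.1); every normal-form argument (closure of `NP` under Karp reductions, Thm. 2.8; `RP ⊆ NP`;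
Cook–Reckhow's Prop. 1.4) needs this bound *tested by a polynomial-time machine* on the pair-coded
input. This file provides the test, assembled — as in `CoinTruncation.lean` — from the `FinTM2`
toolkit without a new machine: the unary clock `evalHdrFn p` (`UnaryArithMachines.lean`), a
recoding transducer `lenInit` (drop `x`, keep the clock as `none`s and the coins of `y` as cells
`1b`), `p(|x|)` clocked rounds of the cell-dropping transducer `lenStep`
(`PolyTimeComputable.iterate_of_le_add`), and the emptiness test `lenOut`.

* `lenLeFn p ∈ FP`, `lenLeFn p ⟨x, y⟩ = [decide (|y| ≤ p |x|)]` (`lenLeFn_boolPair`), and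
  `lenLeFn p w ∈ {[1], [0]}` on every input (`lenLeFn_eq_or`);
* `mem_P_of_mem_FP` — a language whose indicator string function is in `FP` is in `P`;
* `LenLe p = {w | lenLeFn p w = [1]} ∈ P` with `⟨x, y⟩ ∈ LenLe p ↔ |y| ≤ p(|x|)`; the strict
  variant `LenLt p ∈ P` (`|y| < p(|x|)`, preimage of `LenLe p` under the coin-inserting transducer
  `consT : ⟨x, y⟩ ↦ ⟨x, 1y⟩`); and the exact variant `LenEq p ∈ P` (`|y| = p(|x|)`), which is
  `LenLe p ⊓ (LenLt p)ᶜ` and uses the closure of `P` under intersection (`StringCopy.inter_mem_P`)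
  and complement (`PolyTimeDecidable.compl_holds`).

## References

* S. Arora, B. Barak, *Computational Complexity: A Modern Approach*, CUP 2009, Def. 2.1, Thm. 2.8,
  §1.3, §1.4.1.
-/

namespace Literature.Computability.Complexity

open _root_.Computability

namespace LenCmp

/-- The coins of `y` as cells `1b`. [folklore] -/
def cells (y : List Bool) : List Bool :=
  y.flatMap fun b => [true, b]

/-- `cells [] = []`. [folklore] -/
@[simp] theorem cells_nil : cells [] = [] := rfl

/-- `cells (b :: y) = 1 b (cells y)`. [folklore] -/
@[simp] theorem cells_cons (b : Bool) (y : List Bool) : cells (b :: y) = true :: b :: cells y := by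
  simp [cells]

/-! ### Stage 2: `lenInit` -/

/-- States of `lenInit`: first unary block, clock block, pair reader over `x`, coin recoder. [folklore] -/
inductive S₂
  | skip
  | cnt
  | ev
  | od (b : Bool)
  | tl
  deriving DecidableEq, Fintype

/-- Transition of `lenInit`. [folklore] -/
def lenInitStep : S₂ → Bool → S₂ × List (Option Bool)
  | .skip, true => (.skip, [])
  | .skip, false => (.cnt, [])
  | .cnt, true => (.cnt, [none])
  | .cnt, false => (.ev, [])
  | .ev, b => (.od b, [])
  | .od b, b' => (if b = b' then .ev else .tl, [])
  | .tl, b => (.tl, [some true, some b])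

/-- The recoding transducer `1ⁿ 0 1ᵃ 0 ⟨x, y⟩ ↦ noneᵃ ++ (cells y).map some`. [folklore] -/
def lenInit : FST S₂ Bool (Option Bool) where
  init := .skip
  step := lenInitStep
  front := fun _ => []
  keep := fun _ => true

/-- The transition of `lenInit` (definitional). [folklore] -/
@[simp] theorem lenInit_step (s : S₂) (b : Bool) : lenInit.step s b = lenInitStep s b := rfl

/-- The body emitted from state `ev`, as a plain function. [folklore] -/
def evPart : List Bool → List Bool
  | b :: b' :: w => if b = b' then evPart w else cells w
  | _ => []

/-- Payload/count decomposition of the output of `lenInit` on an arbitrary input. [folklore] -/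
def stage2 (w : List Bool) : List Bool × ℕ :=
  (evPart (splitOnes (splitOnes w).2).2, (splitOnes (splitOnes w).2).1)

/-- From `tl` the coins are recoded as cells. [folklore] -/
theorem lenInit_run_tl (w : List Bool) : (lenInit.run .tl w).2 = (cells w).map some := by
  induction w with
  | nil => rfl
  | cons b w ih => simp [FST.run_cons, lenInitStep, ih]

/-- From `ev` the transducer emits `(evPart w).map some`. [folklore] -/
theorem lenInit_run_ev : ∀ w : List Bool, (lenInit.run .ev w).2 = (evPart w).map some
  | [] => rfl
  | [b] => by simp [FST.run_cons, lenInitStep, evPart]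
  | b :: b' :: w => by
    by_cases h : b = b'
    · subst h; simp [FST.run_cons, lenInitStep, evPart, lenInit_run_ev w]
    · simp [FST.run_cons, lenInitStep, evPart, h, lenInit_run_tl]

/-- From `cnt`: the clock as `none`s, then the body. [folklore] -/
theorem lenInit_run_cnt (w : List Bool) :
    (lenInit.run .cnt w).2 = List.replicate (splitOnes w).1 none ++ (evPart (splitOnes w).2).map some := by
  induction w with
  | nil => rfl
  | cons b w ih =>
    cases b
    · simp [FST.run_cons, lenInitStep, splitOnes, lenInit_run_ev]
    · simp [FST.run_cons, lenInitStep, splitOnes, ih, List.replicate_succ]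

/-- **Shape of the output of `lenInit` on every input.** [folklore] -/
theorem lenInit_eval (w : List Bool) :
    lenInit.eval w = List.replicate (stage2 w).2 none ++ ((stage2 w).1).map some := by
  have h : ∀ w : List Bool, (lenInit.run .skip w).2 =
      List.replicate (stage2 w).2 none ++ ((stage2 w).1).map some := by
    intro w
    induction w with
    | nil => rfl
    | cons b w ih =>
      cases b
      · simp [FST.run_cons, lenInitStep, stage2, splitOnes, lenInit_run_cnt]
      · simpa [FST.run_cons, lenInitStep, stage2, splitOnes] using ih
  have he : lenInit.eval w = (lenInit.run .skip w).2 := by simp [FST.eval, lenInit]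
  rw [he, h w]

/-- `evPart ⟨x, y⟩ = cells y`. [folklore] -/
theorem evPart_boolPair (x y : List Bool) : evPart (boolPair x y) = cells y := by
  induction x with
  | nil => simp [boolPair, evPart]
  | cons b x ih =>
    have hc : boolPair (b :: x) y = b :: b :: boolPair x y := by simp [boolPair]
    rw [hc, evPart, if_pos rfl, ih]

/-- On `1ⁿ 0 1ᵃ 0 ⟨x, y⟩` the decomposition is `(cells y, a)`. [folklore] -/
theorem stage2_hdr (n a : ℕ) (x y : List Bool) : stage2 (hdr n a (boolPair x y)) = (cells y, a) := by
  simp [stage2, hdr, evPart_boolPair]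

/-- `stage2` is polynomial-time computable into the input encoding of the iteration combinator. [folklore] -/
theorem polyTimeComputable_lenStage2 :
    PolyTimeComputable (id : List Bool → List Bool)
      (fun q : List Bool × ℕ => List.replicate q.2 none ++ (id q.1).map some) stage2 := by
  obtain ⟨p, M, hM⟩ := lenInit.polyTimeComputable_eval
  refine ⟨p, M, fun w => ?_⟩
  have h := hM w
  simp only [id, lenInit_eval] at h ⊢
  exact h

/-! ### Stage 3: dropping one cell, `lenStep` -/

/-- States of `lenStep`: before the first cell, inside it, copying the rest. [folklore] -/
inductive S₃
  | d0
  | d1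
  | copy
  deriving DecidableEq, Fintype

/-- Transition of `lenStep`: the first cell `1b` is dropped, everything else copied. [folklore] -/
def lenStepStep : S₃ → Bool → S₃ × List Bool
  | .d0, true => (.d1, [])
  | .d0, false => (.copy, [false])
  | .d1, _ => (.copy, [])
  | .copy, c => (.copy, [c])

/-- One round: drop the first cell. [folklore] -/
def lenStep : FST S₃ Bool Bool where
  init := .d0
  step := lenStepStep
  front := fun _ => []
  keep := fun _ => true

/-- The transition of `lenStep` (definitional). [folklore] -/
@[simp] theorem lenStep_step (s : S₃) (b : Bool) : lenStep.step s b = lenStepStep s b := rfl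

/-- The copier of `lenStep`. [folklore] -/
theorem lenStep_run_copy (w : List Bool) : (lenStep.run .copy w).2 = w := by
  induction w with
  | nil => rfl
  | cons b w ih => simp [FST.run_cons, lenStepStep, ih]

/-- **One round on cells drops one coin.** [folklore] -/
theorem lenStep_eval_cells (y : List Bool) : lenStep.eval (cells y) = cells (y.drop 1) := by
  have he : lenStep.eval (cells y) = (lenStep.run .d0 (cells y)).2 := by simp [FST.eval, lenStep]
  rw [he]
  cases y with
  | nil => rfl
  | cons b y => simp [FST.run_cons, lenStepStep, lenStep_run_copy]

/-- **`a` rounds drop `a` coins.** [folklore] -/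
theorem lenStep_iterate_cells (a : ℕ) : ∀ y : List Bool, lenStep.eval^[a] (cells y) = cells (y.drop a) := by
  induction a with
  | zero => intro y; simp
  | succ a ih => intro y; rw [Function.iterate_succ_apply, lenStep_eval_cells, ih, List.drop_drop, add_comm]

/-- `lenStep` never lengthens its input. [folklore] -/
theorem lenStep_length_run_le (w : List Bool) :
    ∀ s : S₃, (lenStep.run s w).2.length ≤ w.length + (if s = .d0 then 0 else 0) := by
  induction w with
  | nil => intro s; simp
  | cons b w ih =>
    intro s
    rcases s with _ | _ | _ <;> cases b <;> simp [FST.run_cons, lenStepStep] <;>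
      first
      | (have := ih .d1; simp at this; omega)
      | (have := ih .copy; simp at this; omega)

/-- `|lenStep w| ≤ |w|`. [folklore] -/
theorem length_lenStep_eval_le (w : List Bool) : (lenStep.eval w).length ≤ w.length := by
  have he : lenStep.eval w = (lenStep.run .d0 w).2 := by simp [FST.eval, lenStep]
  rw [he]
  simpa using lenStep_length_run_le w .d0

/-- **Clocked coin dropping is polynomial time.** [Arora–Barak 2009, §1.4.1] [cite: AroraBarakCC2009, §1.4.1] -/
theorem polyTimeComputable_iterate_lenStep :
    PolyTimeComputable (fun q : List Bool × ℕ => List.replicate q.2 none ++ (id q.1).map some)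
      (id : List Bool → List Bool) (fun q => lenStep.eval^[q.2] q.1) :=
  PolyTimeComputable.iterate_of_le_add (ea := (id : List Bool → List Bool)) 0
    (fun w => by simpa using length_lenStep_eval_le w) lenStep.polyTimeComputable_eval

/-! ### Stage 4: the emptiness test `lenOut` -/

/-- States of `lenOut`: nothing read (accept) or something read (reject). [folklore] -/
inductive S₄
  | empty
  | nonempty
  deriving DecidableEq, Fintype

/-- The emptiness-testing transducer: verdict `[1]` iff the input is empty. [folklore] -/
def lenOut : FST S₄ Bool Bool where
  init := .empty
  step := fun _ _ => (.nonempty, [])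
  front := fun s => [decide (s = .empty)]
  keep := fun _ => false

/-- `lenOut w = [decide (w = [])]`. [folklore] -/
theorem lenOut_eval (w : List Bool) : lenOut.eval w = [decide (w = [])] := by
  have hne : ∀ (w : List Bool) (s : S₄), w ≠ [] → (lenOut.run s w).1 = .nonempty := by
    intro w
    induction w with
    | nil => intro s h; exact absurd rfl h
    | cons b w ih =>
      intro s _
      cases w with
      | nil => simp [FST.run_cons, lenOut]
      | cons c w => simpa [FST.run_cons, lenOut] using ih .nonempty (by simp)
  cases w with
  | nil => simp [FST.eval, lenOut]
  | cons b w =>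
    have h1 := hne (b :: w) .empty (by simp)
    simp only [FST.eval] at h1 ⊢
    rw [show lenOut.init = S₄.empty from rfl, h1]
    simp [lenOut]

end LenCmp

open LenCmp

/-! ### The length test -/

/-- **The witness-length test** `lenLeFn p`, a total string function with
`lenLeFn p ⟨x, y⟩ = [decide (|y| ≤ p |x|)]` (`lenLeFn_boolPair`). [Arora–Barak 2009, Def. 2.1, §1.3] [cite: AroraBarakCC2009, Def. 2.1] -/
noncomputable def lenLeFn (p : Polynomial ℕ) : List Bool → List Bool :=
  lenOut.eval ∘ (fun s : List Bool × ℕ => lenStep.eval^[s.2] s.1) ∘ stage2 ∘ evalHdrFn p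

/-- **`lenLeFn p ⟨x, y⟩ = [decide (|y| ≤ p(|x|))]`.** [Arora–Barak 2009, Def. 2.1] [cite: AroraBarakCC2009, Def. 2.1] -/
theorem lenLeFn_boolPair (p : Polynomial ℕ) (x y : List Bool) :
    lenLeFn p (boolPair x y) = [decide (y.length ≤ p.eval x.length)] := by
  simp only [lenLeFn, Function.comp_apply, evalHdrFn, boolUnpair_boolPair, stage2_hdr,
    lenStep_iterate_cells, lenOut_eval]
  have hcells : ∀ r : List Bool, cells r = [] ↔ r = [] := fun r => by
    cases r <;> simp
  congr 1
  rw [Bool.decide_congr ((hcells _).trans List.drop_eq_nil_iff)]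

/-- The length test always answers `[1]` or `[0]`. [folklore] -/
theorem lenLeFn_eq_or (p : Polynomial ℕ) (w : List Bool) : lenLeFn p w = [true] ∨ lenLeFn p w = [false] := by
  simp only [lenLeFn, Function.comp_apply, lenOut_eval]
  by_cases h : (lenStep.eval^[(stage2 (evalHdrFn p w)).2] (stage2 (evalHdrFn p w)).1) = [] <;> simp [h]

/-- **The length test is in `FP`.** [Arora–Barak 2009, §1.3, Thm. 2.8 (proof)] [cite: AroraBarakCC2009, §1.3] -/
theorem lenLeFn_mem_FP (p : Polynomial ℕ) : lenLeFn p ∈ FP :=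
  PolyTimeComputable.comp_holds lenOut.polyTimeComputable_eval
    (PolyTimeComputable.comp_holds polyTimeComputable_iterate_lenStep
      (PolyTimeComputable.comp_holds polyTimeComputable_lenStage2 (evalHdrFn_mem_FP p)))

/-! ### Languages with an `FP` indicator are in `P` -/

/-- If the string function `w ↦ [w ∈ L]` is in `FP` then `L ∈ P` (the same machine decides `L`).
[Arora–Barak 2009, Def. 1.13] [cite: AroraBarakCC2009, Def. 1.13] -/
theorem mem_P_of_mem_FP {g : List Bool → List Bool} (hg : g ∈ FP) (L : Language Bool)
    (h : ∀ w, (w ∈ L → g w = [true]) ∧ (w ∉ L → g w = [false])) : L ∈ Classes.P := by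
  classical
  obtain ⟨p, M, hM⟩ := hg
  refine mem_P_iff_holds.2 (polyTimeDecidable_iff.2 ⟨p, M, fun w => ?_⟩)
  have hw := hM w
  have he : (id (g w) : List Bool) = encodeBool (L.boolIndicator w) := by
    by_cases hx : w ∈ L
    · rw [id, (h w).1 hx, (Set.mem_iff_boolIndicator _ _).1 hx]; rfl
    · rw [id, (h w).2 hx, (Set.notMem_iff_boolIndicator _ _).1 hx]; rfl
  rw [he] at hw
  exact hw

/-- **The witness-length language** `LenLe p = {w | lenLeFn p w = [1]}`; on pairs,
`⟨x, y⟩ ∈ LenLe p ↔ |y| ≤ p(|x|)`. [Arora–Barak 2009, Def. 2.1] [cite: AroraBarakCC2009, Def. 2.1] -/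
def LenLe (p : Polynomial ℕ) : Language Bool :=
  {w | lenLeFn p w = [true]}

/-- Membership of a pair in `LenLe p`. [Arora–Barak 2009, Def. 2.1] [cite: AroraBarakCC2009, Def. 2.1] -/
@[simp] theorem boolPair_mem_LenLe (p : Polynomial ℕ) (x y : List Bool) :
    boolPair x y ∈ LenLe p ↔ y.length ≤ p.eval x.length := by
  change lenLeFn p (boolPair x y) = [true] ↔ _
  rw [lenLeFn_boolPair]
  simp

/-- **`LenLe p ∈ P`.** [Arora–Barak 2009, Def. 2.1, §1.3] [cite: AroraBarakCC2009, Def. 2.1] -/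
theorem LenLe_mem_P (p : Polynomial ℕ) : LenLe p ∈ Classes.P :=
  mem_P_of_mem_FP (lenLeFn_mem_FP p) _ fun w =>
    ⟨fun h => h, fun h => ((lenLeFn_eq_or p w).resolve_left h)⟩

/-! ### Inserting a coin: strict and exact length tests -/

namespace LenCmp

/-- States of `consT`: pair reader, then copier. [folklore] -/
inductive S₅
  | ev
  | od (b : Bool)
  | copy
  deriving DecidableEq, Fintype

/-- Transition of `consT`: after the separator `01` insert a `1`. [folklore] -/
def consStep : S₅ → Bool → S₅ × List Bool
  | .ev, b => (.od b, [])
  | .od b, b' => if b = b' then (.ev, [b, b']) else (.copy, [b, b', true])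
  | .copy, c => (.copy, [c])

/-- The coin-inserting transducer `⟨x, y⟩ ↦ ⟨x, 1y⟩`. [folklore] -/
def consT : FST S₅ Bool Bool where
  init := .ev
  step := consStep
  front := fun _ => []
  keep := fun _ => true

/-- The transition of `consT` (definitional). [folklore] -/
@[simp] theorem consT_step (s : S₅) (b : Bool) : consT.step s b = consStep s b := rfl

/-- The copier of `consT`. [folklore] -/
theorem consT_run_copy (w : List Bool) : (consT.run .copy w).2 = w := by
  induction w with
  | nil => rfl
  | cons b w ih => simp [FST.run_cons, consStep, ih]

/-- **`consT ⟨x, y⟩ = ⟨x, 1y⟩`.** [folklore] -/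
theorem consT_eval (x y : List Bool) : consT.eval (boolPair x y) = boolPair x (true :: y) := by
  have he : ∀ w : List Bool, consT.eval w = (consT.run .ev w).2 := fun w => by
    simp [FST.eval, consT]
  rw [he]
  induction x with
  | nil => simp [boolPair, FST.run_cons, consStep, consT_run_copy]
  | cons b x ih =>
    have hc : ∀ z : List Bool, boolPair (b :: x) z = b :: b :: boolPair x z := fun z => by simp [boolPair]
    rw [hc, hc]
    simp [FST.run_cons, consStep, ih]

end LenCmp

/-- The **strict** witness-length language: `⟨x, y⟩ ∈ LenLt p ↔ |y| < p(|x|)` (preimage of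
`LenLe p` under `consT`). [Arora–Barak 2009, Def. 2.1] [cite: AroraBarakCC2009, Def. 2.1] -/
def LenLt (p : Polynomial ℕ) : Language Bool :=
  LenCmp.consT.eval ⁻¹' LenLe p

/-- Membership of a pair in `LenLt p`. [Arora–Barak 2009, Def. 2.1] [cite: AroraBarakCC2009, Def. 2.1] -/
@[simp] theorem boolPair_mem_LenLt (p : Polynomial ℕ) (x y : List Bool) :
    boolPair x y ∈ LenLt p ↔ y.length < p.eval x.length := by
  change LenCmp.consT.eval (boolPair x y) ∈ LenLe p ↔ _
  rw [LenCmp.consT_eval, boolPair_mem_LenLe]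
  exact Nat.succ_le_iff

/-- `LenLt p ∈ P`. [Arora–Barak 2009, Def. 2.1] [cite: AroraBarakCC2009, Def. 2.1] -/
theorem LenLt_mem_P (p : Polynomial ℕ) : LenLt p ∈ Classes.P :=
  preimage_mem_P (LenLe_mem_P p) LenCmp.consT.polyTimeComputable_eval

/-- The **exact** witness-length language: `⟨x, y⟩ ∈ LenEq p ↔ |y| = p(|x|)`, i.e. `|y| ≤ p(|x|)`
and not `|y| < p(|x|)`; spelled out with `lenLeFn` so that membership of pairs is by computation
(`boolPair_mem_LenEq`), and equal to `LenLe p ⊓ (LenLt p)ᶜ` (`LenEq_eq`). These are the coin strings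
of the exact length `p(|x|)` sampled by `uniformProb (p |x|)` (Arora–Barak 2009, Def. 7.6 for `RP`).
[Arora–Barak 2009, Def. 2.1 (witness bound), Def. 7.6] [cite: AroraBarakCC2009, Def. 7.6] -/
def LenEq (p : Polynomial ℕ) : Language Bool :=
  {w | lenLeFn p w = [true] ∧ lenLeFn p (LenCmp.consT.eval w) = [false]}

/-- Membership of a pair in `LenEq p`. [Arora–Barak 2009, Def. 2.1] [cite: AroraBarakCC2009, Def. 2.1] -/
@[simp] theorem boolPair_mem_LenEq (p : Polynomial ℕ) (x y : List Bool) :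
    boolPair x y ∈ LenEq p ↔ y.length = p.eval x.length := by
  change lenLeFn p (boolPair x y) = [true] ∧ lenLeFn p (LenCmp.consT.eval (boolPair x y)) = [false] ↔ _
  rw [LenCmp.consT_eval, lenLeFn_boolPair, lenLeFn_boolPair]
  simp only [List.cons.injEq, and_true, decide_eq_true_eq, decide_eq_false_iff_not, not_le,
    List.length_cons]
  omega


/-- `LenEq p = LenLe p ⊓ (LenLt p)ᶜ` (the second conjunct via `lenLeFn_eq_or`). [Arora–Barak 2009, Def. 7.6] [cite: AroraBarakCC2009, Def. 7.6] -/
theorem LenEq_eq (p : Polynomial ℕ) : LenEq p = LenLe p ⊓ (LenLt p)ᶜ := by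
  ext w
  change lenLeFn p w = [true] ∧ lenLeFn p (LenCmp.consT.eval w) = [false] ↔
    lenLeFn p w = [true] ∧ ¬ lenLeFn p (LenCmp.consT.eval w) = [true]
  rcases lenLeFn_eq_or p (LenCmp.consT.eval w) with h1 | h1 <;> simp [h1]

/-- **`LenEq p ∈ P`**, from `LenLe_mem_P`, `LenLt_mem_P`, closure of `P` under complement
(`PolyTimeDecidable.compl_holds`) and intersection (`inter_mem_P`). [Arora–Barak 2009, Def. 7.6, §1.3] [cite: AroraBarakCC2009, Def. 7.6] -/
theorem LenEq_mem_P (p : Polynomial ℕ) : LenEq p ∈ Classes.P := by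
  rw [LenEq_eq]
  exact inter_mem_P (LenLe_mem_P p)
    (mem_P_iff_holds.2 (PolyTimeDecidable.compl_holds (mem_P_iff_holds.1 (LenLt_mem_P p))))

end Literature.Computability.Complexity
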